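import Summits.NavierStokesRegularity.NavierStokesRegularity.Theorems.RungBlowupCofinal.Negative.MeanWaveAngularMean
import Summits.NavierStokesRegularity.NavierStokesRegularity.Theorems.RungBlowupCofinal.Negative.SectoralWaveCasimir
import Summits.NavierStokesRegularity.FluidComputer.AngularGalerkinLadderRadialCutoff
import HarnessLib

/-!
# A co-band-limited defect is `L²_γ`-orthogonal to band-limited fields: the Galerkin defect is
# invisible in Pineau–Vicol's Gaussian-weighted angular energy pairings
# (route `AngularGalerkinLadder`, crux K1 `RungBlowupCofinal`; Negative lane, theorems only)

Negative-lane bookkeeping for `stmt-NavierStokesRegularity-19959` (K1 of route №8), cell ns-blowup,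
refuter5 (K5-79), sequel of `MeanWaveAngularMean` (K5-78: the line's `J₃` is Pineau–Vicol's `𝓡`,
`V = ⟨U⟩_θ`, `W = (U)_a`). Nothing here asserts a Theses declaration; no definition, no named
fact. WHAT THIS IS NOT: not Navier–Stokes evidence — an orthogonality statement for the MODEL
`NS_L` vocabulary (co-band-limited defects against band-limited fields) with a radial weight; no
rung dynamics, no profile is constructed or excluded.

## Content

* **`integral_radial_mul_inner_eq_zero`** — for `g` co-band-limited of degree `L` and continuous,
  `u` band-limited of degree `L`, and ANY smooth radial weight `ρ(‖x‖²)` making the pairing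
  integrable: `∫ ρ(‖x‖²) ⟪g x, u x⟫ dx = 0`. Proof: the cut-off weights `φ(‖x‖²/(k+1)) ρ(‖x‖²)`
  (`φ` a smooth bump, `= 1` on `[−1,1]`) are admissible radial profiles, so each cut-off pairing
  vanishes exactly (`IsCobandLimited.integral_inner_radial_smul`, the tree's "the defect does no
  work on radially cut-off band-limited slices"); dominated convergence.
* **`integral_gaussWeight_mul_inner_eq_zero`**, `…_of_norm_le` — the case of Pineau–Vicol's weight
  `γ(x) = e^{−‖x‖²/4}` (`Literature.Analysis.FluidPDE.PineauVicol2026.gaussWeight`), with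
  integrability from polynomial growth of both fields.
* In the letters of the lines `leray` / `qlwave` (precessing rung profiles `U`, defect `E`
  co-band-limited, `U` band-limited): **`integral_gaussWeight_mul_inner_angGen_eq_zero`**
  (`∫ γ⟪E, J₃U⟫ = 0`, since `J₃U` is band-limited — K5-75 `isBandLimited_angGen`) and
  **`integral_gaussWeight_mul_inner_eq_zero_of_tail`** (`∫ γ⟪E, W⟫ = 0` for band-limited `W` with
  the Type-I tail `‖W y‖ ≤ C/(‖y‖+1)`), both under a polynomial growth bound on `E`.

Reading for the line (refuter handle recorded in K5-78): in Pineau–Vicol's large-`|α|` mechanism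
the profile equation `α𝓡U + ½U + ½DU[y] − ΔU = 𝓢` is paired in `L²_γ` with `𝓡U = J₃U` ((6.18))
and with `(U)_a` ((6.19)); for an `NS_L` rung profile the source `𝓢` carries the extra Galerkin
defect `E`, and by the two corollaries above **that defect contributes nothing to either
pairing** — Lemma 6.4 / Proposition 6.5 (formalised for a general source in
`PineauVicolAngularMean`) see an `NS_L` precessing profile exactly as they see an NS one, GIVEN a
polynomial growth bound on `E` and on `J₃U` (equivalently on `|y| |∇U|`), which the line's
`IsMeanWaveProfile` / `IsPrecessingRungProfile` do not carry (for NS they follow from parabolic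
regularity of the ancient solution, PV Lemma 2.1). [cite: PineauVicol2026, §6.2 (6.7), Lemma 6.2,
Lemma 6.4 (6.17)–(6.19) (arXiv:2607.09619 pp. 19–22)].
-/

noncomputable section

namespace Summit.NavierStokesRegularity.AngularGalerkinLadderCobandGaussPairing

open Set Function MeasureTheory Filter Topology Metric
open scoped ContDiff RealInnerProductSpace
open Literature.Analysis.FluidPDE Literature.Analysis.FluidPDE.PineauVicol2026
open Summit.NavierStokesRegularity.FluidComputer
open Summit.NavierStokesRegularity.FluidComputer.AngularLadder

variable {g u : EuclideanSpace ℝ (Fin 3) → EuclideanSpace ℝ (Fin 3)} {L : ℕ}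

/-- **A co-band-limited field is orthogonal to radially WEIGHTED band-limited fields**, for any
smooth radial weight making the pairing integrable: `∫ ρ(‖x‖²) ⟪g, u⟫ = 0` — by exhausting the
weight with radial bumps (`IsCobandLimited.integral_inner_radial_smul`) and dominated convergence.
[folklore] -/
theorem integral_radial_mul_inner_eq_zero (hg : IsCobandLimited L g) (hgc : Continuous g)
    (hu : IsBandLimited L u) {ρ : ℝ → ℝ} (hρ : ContDiff ℝ ∞ ρ)
    (hint : Integrable fun x => ρ (‖x‖ ^ 2) * ⟪g x, u x⟫) :
    ∫ x, ρ (‖x‖ ^ 2) * ⟪g x, u x⟫ = 0 := by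
  -- a smooth bump `φ = 1` on `[-1, 1]`, supported in `(-2, 2)`, `0 ≤ φ ≤ 1`
  let φ : ContDiffBump (0 : ℝ) := ⟨1, 2, one_pos, one_lt_two⟩
  let χ : ℕ → ℝ → ℝ := fun k s => φ (((k : ℝ) + 1)⁻¹ • s)
  have hk : ∀ k : ℕ, ((k : ℝ) + 1)⁻¹ ≠ 0 := fun k => inv_ne_zero (by positivity)
  have hχs : ∀ k, ContDiff ℝ ∞ (χ k) := fun k => by
    show ContDiff ℝ ∞ (fun s => φ ((((k : ℝ) + 1)⁻¹) • s))
    exact φ.contDiff.comp (contDiff_id.const_smul _)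
  have hχc : ∀ k, HasCompactSupport (χ k) := fun k => φ.hasCompactSupport.comp_smul (hk k)
  have hχ01 : ∀ k s, 0 ≤ χ k s ∧ χ k s ≤ 1 := fun k s => ⟨φ.nonneg, φ.le_one⟩
  -- the cut-off weights `χ_k ρ` are admissible radial profiles: each pairing vanishes
  set G : EuclideanSpace ℝ (Fin 3) → ℝ := fun x => ρ (‖x‖ ^ 2) * ⟪g x, u x⟫ with hG
  have hzero : ∀ k, ∫ x, χ k (‖x‖ ^ 2) * G x = 0 := by
    intro k
    have h := hg.integral_inner_radial_smul hu ((hχs k).mul hρ) ((hχc k).mul_right (f' := ρ))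
    have e : (fun x => ⟪g x, (χ k (‖x‖ ^ 2) * ρ (‖x‖ ^ 2)) • u x⟫) =
        fun x => χ k (‖x‖ ^ 2) * G x := by
      funext x; rw [real_inner_smul_right, hG, mul_assoc]
    simpa only [Pi.mul_apply, e] using h
  -- dominated convergence `χ_k(‖x‖²) G → G`
  have hGc : Continuous G :=
    (hρ.continuous.comp (continuous_norm.pow 2)).mul (hgc.inner hu.1.continuous)
  have hlim : Tendsto (fun k => ∫ x, χ k (‖x‖ ^ 2) * G x) atTop (𝓝 (∫ x, G x)) := by
    refine tendsto_integral_of_dominated_convergence (fun x => ‖G x‖) (fun k => ?_) hint.norm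
      (fun k => Eventually.of_forall fun x => ?_) (Eventually.of_forall fun x => ?_)
    · exact (((hχs k).continuous.comp (continuous_norm.pow 2)).mul hGc).aestronglyMeasurable
    · rw [norm_mul, Real.norm_of_nonneg (hχ01 k _).1]
      exact mul_le_of_le_one_left (norm_nonneg _) (hχ01 k _).2
    · -- eventually `χ_k(‖x‖²) = 1`
      obtain ⟨k₀, hk₀⟩ := exists_nat_ge (‖x‖ ^ 2)
      refine (tendsto_const_nhds (x := G x)).congr' ?_
      filter_upwards [eventually_ge_atTop k₀] with k hkk
      have hk1 : ‖x‖ ^ 2 ≤ (k : ℝ) + 1 := by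
        have : (k₀ : ℝ) ≤ k := Nat.cast_le.2 hkk
        linarith
      have hmem : ((k : ℝ) + 1)⁻¹ • ‖x‖ ^ 2 ∈ closedBall (0 : ℝ) φ.rIn := by
        rw [mem_closedBall, dist_zero_right, smul_eq_mul, Real.norm_eq_abs, abs_of_nonneg
          (mul_nonneg (inv_nonneg.2 (by positivity)) (sq_nonneg _))]
        rw [inv_mul_le_iff₀ (by positivity)]
        show ‖x‖ ^ 2 ≤ ((k : ℝ) + 1) * 1
        simpa using hk1
      have h1 : χ k (‖x‖ ^ 2) = 1 := φ.one_of_mem_closedBall hmem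
      rw [h1, one_mul]
  have hconst : (fun k => ∫ x, χ k (‖x‖ ^ 2) * G x) = fun _ => 0 := funext hzero
  rw [hconst] at hlim
  exact tendsto_nhds_unique hlim tendsto_const_nhds

/-- The Gaussian weight `γ(x) = e^{−‖x‖²/4}` of Pineau–Vicol: **a co-band-limited field is
`L²_γ`-orthogonal to every band-limited field** (pairing integrable).
[cite: PineauVicol2026, §6.2 (6.7) (p. 19)] -/
theorem integral_gaussWeight_mul_inner_eq_zero (hg : IsCobandLimited L g) (hgc : Continuous g)
    (hu : IsBandLimited L u) (hint : Integrable fun x => gaussWeight x * ⟪g x, u x⟫) :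
    ∫ x, gaussWeight x * ⟪g x, u x⟫ = 0 := by
  have hρ : ContDiff ℝ ∞ (fun s : ℝ => Real.exp (-s / 4)) := by fun_prop
  have e : (fun x : EuclideanSpace ℝ (Fin 3) => gaussWeight x * ⟪g x, u x⟫) =
      fun x => Real.exp (-(‖x‖ ^ 2) / 4) * ⟪g x, u x⟫ := by
    funext x; rfl
  rw [e] at hint ⊢
  exact integral_radial_mul_inner_eq_zero hg hgc hu hρ hint

/-- Polynomial growth of both fields suffices for the integrability. [folklore] -/
theorem integral_gaussWeight_mul_inner_eq_zero_of_norm_le (hg : IsCobandLimited L g)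
    (hgc : Continuous g) (hu : IsBandLimited L u) {Cg Cu : ℝ} {Ng Nu : ℕ}
    (hgb : ∀ y, ‖g y‖ ≤ Cg * (1 + ‖y‖) ^ Ng) (hub : ∀ y, ‖u y‖ ≤ Cu * (1 + ‖y‖) ^ Nu) :
    ∫ x, gaussWeight x * ⟪g x, u x⟫ = 0 := by
  refine integral_gaussWeight_mul_inner_eq_zero hg hgc hu
    (integrable_gaussWeight_mul_of_norm_le (hgc.inner hu.1.continuous) (C := Cg * Cu)
      (N := Ng + Nu) fun y => ?_)
  have hCg : 0 ≤ Cg := by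
    have := (norm_nonneg (g 0)).trans (hgb 0); simpa using this
  calc ‖⟪g y, u y⟫‖ ≤ ‖g y‖ * ‖u y‖ := norm_inner_le_norm _ _
    _ ≤ (Cg * (1 + ‖y‖) ^ Ng) * (Cu * (1 + ‖y‖) ^ Nu) :=
        mul_le_mul (hgb y) (hub y) (norm_nonneg _) (by positivity)
    _ = Cg * Cu * (1 + ‖y‖) ^ (Ng + Nu) := by ring

/-! ## In the letters of the precessing / mean–wave lines -/

section Letters

variable {E U W : EuclideanSpace ℝ (Fin 3) → EuclideanSpace ℝ (Fin 3)}

/-- **The defect is invisible in the `L²_γ` pairing with `J₃U`**: for a co-band-limited continuous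
defect of polynomial growth and a band-limited `U` whose `J₃U` has polynomial growth,
`∫ γ ⟪E, J₃U⟫ = 0` (`J₃U` is band-limited, `[J₃, 𝒞] = 0`). This is the term by which the
Galerkin defect would enter Pineau–Vicol's (6.18). -/
theorem integral_gaussWeight_mul_inner_angGen_eq_zero (hE : IsCobandLimited L E)
    (hEc : Continuous E) {CE : ℝ} {NE : ℕ} (hEb : ∀ y, ‖E y‖ ≤ CE * (1 + ‖y‖) ^ NE)
    (hU : IsBandLimited L U) {CJ : ℝ} {NJ : ℕ} (hJb : ∀ y, ‖angGen 2 U y‖ ≤ CJ * (1 + ‖y‖) ^ NJ) :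
    ∫ x, gaussWeight x * ⟪E x, angGen 2 U x⟫ = 0 :=
  integral_gaussWeight_mul_inner_eq_zero_of_norm_le hE hEc
    (Summit.NavierStokesRegularity.AngularGalerkinLadderSectoralWave.isBandLimited_angGen hU 2)
    hEb hJb

/-- **The defect is invisible in the `L²_γ` pairing with the wave part**: for a co-band-limited
continuous defect of polynomial growth and a band-limited `W` with the line's Type-I tail
`‖W y‖ ≤ C/(‖y‖+1)`, `∫ γ ⟪E, W⟫ = 0`. This is the term by which the defect would enter
Pineau–Vicol's (6.19) (with `W = (U)_a`). -/
theorem integral_gaussWeight_mul_inner_eq_zero_of_tail (hE : IsCobandLimited L E)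
    (hEc : Continuous E) {CE : ℝ} {NE : ℕ} (hEb : ∀ y, ‖E y‖ ≤ CE * (1 + ‖y‖) ^ NE)
    (hW : IsBandLimited L W) {C : ℝ} (htail : ∀ y, ‖W y‖ ≤ C / (‖y‖ + 1)) :
    ∫ x, gaussWeight x * ⟪E x, W x⟫ = 0 := by
  have hC : 0 ≤ C := by
    have h := (norm_nonneg (W 0)).trans (htail 0)
    simpa using h
  refine integral_gaussWeight_mul_inner_eq_zero_of_norm_le hE hEc hW hEb (Cu := C) (Nu := 0)
    fun y => ?_
  rw [pow_zero, mul_one]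
  exact (htail y).trans (div_le_self hC (by linarith [norm_nonneg y]))

end Letters

end Summit.NavierStokesRegularity.AngularGalerkinLadderCobandGaussPairing

end
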